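import Mathlib
import Summits.Ventures.HodgeRepro2.Tier7.Line3.AdicCompletionLocalField

/-!
# Tier7/Line3/AdicCompletionInvolution — the involution of the local field from a valuation-preserving automorphism
(seat t7-x1, gen 4; the σ-row of the level-place dictionary on Mathlib's completions)

LINE 3 (t7-plan-3), version (ii). After AdicCompletionLocalField (p703140) the [W] column of the level-place chain at
`v₁` starts with «`σ` the isometric involution of `E_{v₁}`» (REPAIR CENSUS v14 §C (h⁗′); crit-2 STATUS l. 15720 (c)).
This module produces that `σ` on Mathlib's completion from an ALGEBRAIC clause on the number field: for a number field
`E`, a finite place `w : HeightOneSpectrum (𝓞 E)` and a ring endomorphism `σ : E →+* E` that PRESERVES THE `w`-ADIC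
VALUATION (`hσ : ∀ x, w.valuation E (σ x) = w.valuation E x`),

* `uniformContinuous_liftWithVal`: the lift `WithVal.map _ _ σ` of `σ` to `WithVal (w.valuation E)` is uniformly
  continuous for the valued uniformity — the entourage basis `Valued.hasBasis_uniformity` is mapped to itself with the SAME
  index (`restrict_lt_iff_lt_embedding` + `hσ`), no value-group transport;
* `completionMap w σ hσ : w.adicCompletion E →+* w.adicCompletion E` — the extension to the completion
  (`UniformSpace.Completion.mapRingHom` through `adicCompletion.equiv`), with `completionMap_embedding`
  (`completionMap (embedding w x) = embedding w (σ x)`), `continuous_completionMap`, `norm_completionMap`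
  (`‖completionMap x‖ = ‖x‖`: a closed condition checked on the dense image of `E` through
  `FinitePlace.norm_embedding`, `adicAbv_def` and `hσ`), and `completionMap_completionMap` (an involution of `E` extends
  to an involution of the completion, by density);
* `concrete_kappaData_b_fields_involution`: AdicCompletionLocalField's assembly with `σ := completionMap w σ hσ` and the
  continuity / isometry binders `hσc`, `hσn` DISCHARGED.

WHAT THIS CHANGES IN THE [W] COLUMN: the analytic clause «`σ` continuous and isometric on `E_{v₁}`» becomes the algebraic
clause `hσ` on `E` itself — «the Galois involution of `E/E⁺` preserves the `w`-adic valuation» (true because `w` is the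
ONLY place of `E` above the inert `v₁`; its kernel form from Mathlib's Galois action on `primesOver` is a further row,
not this one). DICTIONARY (in words): `E` the CM field, `w` the place above the inert `v₁`, `σ` the Galois involution
of `E/E⁺`; `f` / `P`, `χA` / `ψB`, `loc γ`, (C), the places `≠ v₁` in `bS` unchanged. Nothing here is about (N), (P),
the real `X`, or HC_CM; §8(d): NO. Blind lane: Mathlib + the HodgeRepro2 prefix; no sorry;
axioms ⊆ {propext, Classical.choice, Quot.sound}.
-/

namespace Summit.Ventures.HodgeRepro2.Tier7.Line3.AdicCompletionInvolution

open IsDedekindDomain IsDedekindDomain.HeightOneSpectrum NumberField Valuation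
open scoped Valued NumberField WithZero

variable {E : Type*} [Field E] [NumberField E] (w : HeightOneSpectrum (𝓞 E)) (σ : E →+* E)

/-! ## The lift of `σ` to `WithVal (w.valuation E)` is uniformly continuous -/

/-- the lift of `σ` to the type synonym `WithVal (w.valuation E)`. -/
noncomputable def liftWithVal : WithVal (w.valuation E) →+* WithVal (w.valuation E) :=
  WithVal.map (w.valuation E) (w.valuation E) σ

/-- `liftWithVal` on elements. -/
theorem liftWithVal_apply (x : WithVal (w.valuation E)) :
    liftWithVal w σ x = WithVal.toVal (w.valuation E) (σ x.ofVal) := rfl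

variable (hσ : ∀ x, w.valuation E (σ x) = w.valuation E x)
include hσ

/-- the lift preserves the valuation of the synonym. -/
theorem valued_liftWithVal (x : WithVal (w.valuation E)) :
    Valued.v (liftWithVal w σ x) = Valued.v x := by
  rw [liftWithVal_apply]
  change w.valuation E (σ x.ofVal) = w.valuation E x.ofVal
  exact hσ _

/-- **the lift of a valuation-preserving endomorphism is uniformly continuous** for the valued uniformity
(the entourage basis is preserved index by index). -/
theorem uniformContinuous_liftWithVal : UniformContinuous (liftWithVal w σ) := by
  rw [(Valued.hasBasis_uniformity (WithVal (w.valuation E)) ℤᵐ⁰).uniformContinuous_iff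
    (Valued.hasBasis_uniformity (WithVal (w.valuation E)) ℤᵐ⁰)]
  intro γ _
  refine ⟨γ, trivial, fun x y hxy => ?_⟩
  simp only [Set.mem_setOf_eq] at hxy ⊢
  rw [restrict_lt_iff_lt_embedding] at hxy ⊢
  rw [← _root_.map_sub, valued_liftWithVal w σ hσ]
  exact hxy

/-- the lift is continuous. -/
theorem continuous_liftWithVal : Continuous (liftWithVal w σ) :=
  (uniformContinuous_liftWithVal w σ hσ).continuous

/-! ## The extension to the completion -/

/-- **the extension of `σ` to the `w`-adic completion**, as a ring endomorphism. -/
noncomputable def completionMap : w.adicCompletion E →+* w.adicCompletion E :=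
  ((adicCompletion.equiv E w).symm.toRingHom.comp
    (UniformSpace.Completion.mapRingHom (liftWithVal w σ) (continuous_liftWithVal w σ hσ))).comp
    (adicCompletion.equiv E w).toRingHom

/-- `completionMap` on the image of `E`: it is `σ`. -/
theorem completionMap_embedding (x : E) :
    completionMap w σ hσ (FinitePlace.embedding w x) = FinitePlace.embedding w (σ x) := by
  have h1 : ∀ y : E, FinitePlace.embedding w y = (adicCompletion.equiv E w).symm
      (((WithVal.equiv (w.valuation E)).symm y : WithVal (w.valuation E)) : (w.valuation E).Completion) :=
    fun _ => rfl
  rw [h1, h1]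
  change (adicCompletion.equiv E w).symm (UniformSpace.Completion.mapRingHom (liftWithVal w σ)
    (continuous_liftWithVal w σ hσ) ((adicCompletion.equiv E w) ((adicCompletion.equiv E w).symm _))) = _
  rw [RingEquiv.apply_symm_apply, UniformSpace.Completion.mapRingHom_coe]
  rfl

/-- `completionMap` on the coercion of an element of `E`. -/
theorem completionMap_coe (x : E) :
    completionMap w σ hσ (x : w.adicCompletion E) = ((σ x : E) : w.adicCompletion E) :=
  completionMap_embedding w σ hσ x

/-- `completionMap` is continuous. -/
theorem continuous_completionMap : Continuous (completionMap w σ hσ) := by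
  have h1 : Continuous (UniformSpace.Completion.mapRingHom (liftWithVal w σ) (continuous_liftWithVal w σ hσ)) :=
    UniformSpace.Completion.continuous_map
  exact (adicCompletion.continuous_ofCompletion E w).comp
    (h1.comp (adicCompletion.continuous_toCompletion E w))

/-- `σ` preserves the `w`-adic absolute value of `E`. -/
theorem adicAbv_apply (x : E) :
    NumberField.HeightOneSpectrum.adicAbv E w (σ x) = NumberField.HeightOneSpectrum.adicAbv E w x := by
  rw [NumberField.HeightOneSpectrum.adicAbv_def, NumberField.HeightOneSpectrum.adicAbv_def, hσ]

/-- **`completionMap` is an isometry**: `‖completionMap x‖ = ‖x‖` on the whole completion (a closed condition,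
checked on the dense image of `E`). -/
theorem norm_completionMap (x : w.adicCompletion E) : ‖completionMap w σ hσ x‖ = ‖x‖ := by
  refine (denseRange_algebraMap E w).induction_on x
    (isClosed_eq ((continuous_completionMap w σ hσ).norm) continuous_norm) fun a => ?_
  change ‖completionMap w σ hσ (FinitePlace.embedding w a)‖ = ‖FinitePlace.embedding w a‖
  rw [completionMap_embedding, FinitePlace.norm_embedding, FinitePlace.norm_embedding, adicAbv_apply w σ hσ]

/-- **an involution of `E` extends to an involution of the completion** (by density). -/
theorem completionMap_completionMap (hσσ : ∀ x, σ (σ x) = x) (x : w.adicCompletion E) :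
    completionMap w σ hσ (completionMap w σ hσ x) = x := by
  refine (denseRange_algebraMap E w).induction_on x
    (isClosed_eq ((continuous_completionMap w σ hσ).comp (continuous_completionMap w σ hσ)) continuous_id)
    fun a => ?_
  change completionMap w σ hσ (completionMap w σ hσ (FinitePlace.embedding w a)) = FinitePlace.embedding w a
  rw [completionMap_embedding, completionMap_embedding, hσσ]

/-! ## The level-place assembly with the extended involution -/

open Matrix MeasureTheory
  Summit.Ventures.HodgeRepro2.Tier7.Line3.CongruenceSubgroup
  Summit.Ventures.HodgeRepro2.Tier7.Line3.TorusSupport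
  Summit.Ventures.HodgeRepro2.Tier7.Line3.LevelTowerTopology
  Summit.Ventures.HodgeRepro2.Tier7.Line3.LevelFactor

/-- **the level-place assembly with `σ := completionMap w σ hσ`**: AdicCompletionLocalField's statement
(ConcreteLevelFactor p698828 at `F := w.adicCompletion E`) with the continuity and isometry binders of `σ` DISCHARGED —
what remains displayed about `σ` is the algebraic clause `hσ` on the number field `E`. -/
theorem concrete_kappaData_b_fields_involution
    (f : Fin 2 → Fin 2 → w.adicCompletion E) (P : GL (Fin 2) (w.adicCompletion E))
    (hP : ∀ j, (P : Matrix (Fin 2) (Fin 2) (w.adicCompletion E)).col j = f j)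
    {q : ℝ} (hq : 1 < q)
    (hB : ∀ b : torusB (completionMap w σ hσ) f, EntryLE normAbv 1
      ((iotaB (completionMap w σ hσ) f b : GL (Fin 2) (w.adicCompletion E)) :
        Matrix (Fin 2) (Fin 2) (w.adicCompletion E)))
    (hB' : ∀ b : torusB (completionMap w σ hσ) f, EntryLE normAbv 1
      (((iotaB (completionMap w σ hσ) f b)⁻¹ : GL (Fin 2) (w.adicCompletion E)) :
        Matrix (Fin 2) (Fin 2) (w.adicCompletion E)))
    {Orb : Type*} (χA : torusA (completionMap w σ hσ) →* ℂ) (ψB : torusB (completionMap w σ hσ) f →* ℂ)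
    (hχA : ∀ a, ‖χA a‖ = 1) (hψB : ∀ b, ‖ψB b‖ = 1)
    (hχA' : IsLocallyConstant (χA : torusA (completionMap w σ hσ) → ℂ))
    (hψB' : IsLocallyConstant (ψB : torusB (completionMap w σ hσ) f → ℂ))
    (loc : Orb → GL (Fin 2) (w.adicCompletion E)) (γ₀ : Orb)
    (hmatch : ∀ a b, (iotaA (completionMap w σ hσ) a)⁻¹ * loc γ₀ * iotaB (completionMap w σ hσ) f b = loc γ₀ →
      χA a * ψB b = 1)
    (arithS : Orb → Prop) (bS : Orb → ℂ) (bS_support : ∀ γ, bS γ ≠ 0 → arithS γ) (C : ℝ) (size : Orb → ℝ)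
    (ε : ℝ) (bS_bound : ∀ γ, arithS γ → ‖bS γ‖ ≤ C * (1 + size γ) ^ ε * ‖bS γ₀‖) (bS_γ₀ : bS γ₀ ≠ 0) :
    ∃ (mA : MeasurableSpace (torusA (completionMap w σ hσ)))
      (mB : MeasurableSpace (torusB (completionMap w σ hσ) f))
      (μA : Measure (torusA (completionMap w σ hσ))) (μB : Measure (torusB (completionMap w σ hσ) f))
      (D : LevelFactorData (torusA (completionMap w σ hσ)) (torusB (completionMap w σ hσ) f)
        (GL (Fin 2) (w.adicCompletion E)) Orb μA μB),
      (@BorelSpace (torusA (completionMap w σ hσ)) _ mA) ∧ (@BorelSpace (torusB (completionMap w σ hσ) f) _ mB) ∧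
      μA.IsHaarMeasure ∧ μB.IsHaarMeasure ∧
      D.ιA = iotaA (completionMap w σ hσ) ∧ D.ιB = iotaB (completionMap w σ hσ) f ∧
      D.K = levelTower normAbv isNonarchimedean_normAbv hq ∧
      D.loc = loc ∧ D.γ₀ = γ₀ ∧ D.arithS = arithS ∧ D.bS = bS ∧ D.size = size ∧ D.ε = ε ∧
      (∀ N γ, D.b N γ ≠ 0 → D.arith N γ) ∧
      (∃ Bb : ℝ, ∀ N γ, D.arith N γ → ‖D.b N γ‖ ≤ Bb * (1 + D.size γ) ^ D.ε * ‖D.b N D.γ₀‖) ∧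
      (∃ N₀ : ℕ, ∀ N ≥ N₀, D.b N D.γ₀ ≠ 0) :=
  AdicCompletionLocalField.concrete_kappaData_b_fields_adicCompletion w (completionMap w σ hσ)
    (continuous_completionMap w σ hσ) (norm_completionMap w σ hσ) f P hP hq hB hB' χA ψB hχA hψB hχA' hψB'
    loc γ₀ hmatch arithS bS bS_support C size ε bS_bound bS_γ₀

end Summit.Ventures.HodgeRepro2.Tier7.Line3.AdicCompletionInvolution
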